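import Literature.Barriers.CriticalPhenomena.RigorousRGSmallParameterRGStepAlgebra
import Literature.Barriers.CriticalPhenomena.RigorousRGSmallParameterReblockingFactorisation
import Literature.Barriers.CriticalPhenomena.RigorousRGSmallParameterKChangeOfVariablesFactorisation
import Literature.Barriers.CriticalPhenomena.RigorousRGSmallParameterTorusGeometry
import Literature.Barriers.CriticalPhenomena.RigorousRGSmallParameterFluctuationAlgebra
import HarnessLib

/-!
# `RigorousRGSmallParameter` (Slade, Theorem 1.4.1): the Gaussian renormalisation group step —
# `K^{(3)} ∈ 𝒦_{j+1}` and the representation identity `𝔼_{C}θ(I ∘ K)(Λ) = e^{-δu₊|Λ|}(I₊ ∘ K₊)(Λ)`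
# with all algebraic hypotheses discharged for `𝔼₊ = 𝔼_{C}`, `θF(φ,ζ) = F(φ+ζ)`

Companion ("proof architecture") file of
`Literature/Barriers/CriticalPhenomena/RigorousRGSmallParameter.lean`. Slade §6.3: "`K₊ = K₊(V,K)`
… with the property that `𝔼₊θ(I ∘ K)(Λ) = e^{-δu₊|Λ|}(I₊ ∘ K₊)(Λ)`. The maps are defined in
[BS-rg-step]." The companion files prove this for the composite `K₊ = Map 6 ∘ ⋯ ∘ Map 1 (K)`
over abstract operators (`…RGStepAlgebra.expect_theta_circ_eq_kPlus`), with the component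
factorisation of `K^{(3)}` (`…ReblockingFactorisation.kthree_eq_prod_components`) resting on the
factorisation property (Efaczz) of `𝔼₊`. Here the operators are the concrete ones of
`…FluctuationAlgebra` (`θ = thetaHom`, `ι = iotaHom`, `E = expectOp (fieldGaussian Λ C n)` on
`Λ = (ℤ/Mℤ)^d`, fields in `ℝⁿ`) and every algebraic/locality hypothesis is DISCHARGED:

* `measurable_blockProd/circ/kout`, `dependsOn_circ`; **`supHyp_flucDep`** (the `Sup`-hypotheses
  for `FlucDep`: "the field locality is straightforward"); **`expectF_mul_of_sepCond`** ((Efaczz)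
  for `𝔼_{C}` with `C` of `ℓ^∞`-range `r`, `r + 2^{d+1}L^j ≤ L^{j+1} + 1`, `L^{j+1} ∣ L^N`: from
  `…GaussianFactorisation` (uncorrelated Gaussians are independent, [BS-rg-norm] §2.11) and
  `…TorusGeometry` (non-touching `(j+1)`-polymers have `j`-scale small-set neighbourhoods farther
  apart than `r`));
* `StepRegular` (locality `I(B), Î(B) ∈ 𝒩(B^□)`, `J(U,B) ∈ 𝒩(B^□)` on `𝒟(J)`, `K(Y) ∈ 𝒩(Y^□)`,
  measurability, support of `J`, factorisation of `K` — Slade Definition 6.1.2 / [BS-rg-step]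
  (4.1)–(4.3)); `loc_kOne`, `loc_kTwo`, `kOne_union`, **`kTwo_union`** ("field locality, symmetry
  and component factorisation properties [of `K^{(2)}`] can be verified by inspection",
  [BS-rg-step] Lemma (lem:K2)), `kTwo_empty`;
* **`kThree_eq_prod_components_gauss`**: `K^{(3)}(U) = ∏_{Z ∈ Comp_{j+1}(U)} K^{(3)}(Z)`;
* **`expectF_theta_circ_eq_kPlus`**: the representation identity for the Gaussian step, whose only
  remaining hypotheses are analytic (integrability of the Map-3 terms `(δI ∘ θK^{(2)})(Y)` in the
  fluctuation field) or definitional for the concrete step data (support of `h_ldg` on `𝒟_{j+1}`,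
  `I_pt⁺(B) = e^{-δu₊|B|}I₊(B)`).

Sources: D. C. Brydges, G. Slade, J. Stat. Phys. 159 (2015) 589–667, arXiv:1403.7256, §1.3,
§3.1, §4.3, §5.1; Brydges–Slade I, arXiv:1403.7244, §2.11; G. Slade, arXiv:1611.06169, §4.1,
§6.1, §6.3.

## References

* [BrydgesSlade2015RGI] D. C. Brydges, G. Slade, *A renormalisation group method. I*, J. Stat.
  Phys. **159** (2015) 421–460, arXiv:1403.7244.
* [BrydgesSlade2015RGV] D. C. Brydges, G. Slade, *A renormalisation group method. V*, J. Stat.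
  Phys. **159** (2015) 589–667, arXiv:1403.7256.
* [Slade2017] G. Slade, *Critical exponents for long-range O(n) models below the upper critical
  dimension*, Commun. Math. Phys. **358** (2018) 343–436, arXiv:1611.06169.
-/

noncomputable section

namespace Literature.Barriers.CriticalPhenomena

namespace LongRangePhi4

namespace Polymer

open _root_.MeasureTheory _root_.ProbabilityTheory Finset Literature.Probability.LatticeModels

variable {d M n : ℕ} [NeZero M]

/-! ## The Gaussian renormalisation group step: discharging the abstract hypotheses -/

section Measurability

variable {X : Type*} [MeasurableSpace X] {b : ℕ}

/-- A finite product of measurable real functions (product taken in the function ring) is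
measurable. [folklore] -/
theorem measurable_pi_prod {ι : Type*} {s : Finset ι} {f : ι → X → ℝ} (hf : ∀ i ∈ s, Measurable (f i)) :
    Measurable (∏ i ∈ s, f i) := by
  have : (∏ i ∈ s, f i) = fun a => ∏ i ∈ s, f i a := by
    funext a; exact Finset.prod_apply a s f
  rw [this]
  exact Finset.measurable_prod s hf

/-- A finite sum of measurable real functions (sum taken in the function ring) is measurable. [folklore] -/
theorem measurable_pi_sum {ι : Type*} {s : Finset ι} {f : ι → X → ℝ} (hf : ∀ i ∈ s, Measurable (f i)) :
    Measurable (∑ i ∈ s, f i) := by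
  have : (∑ i ∈ s, f i) = fun a => ∑ i ∈ s, f i a := by
    funext a; exact Finset.sum_apply a s f
  rw [this]
  exact Finset.measurable_sum s hf

/-- `I^Y` is measurable when the block factors are. [folklore] -/
theorem measurable_blockProd {I : Finset (TorusSite d M) → X → ℝ} (hI : ∀ x, Measurable (I (block b x)))
    (Y : Finset (TorusSite d M)) : Measurable (blockProd b I Y) := by
  unfold blockProd
  refine measurable_pi_prod fun B hB => ?_
  obtain ⟨x, -, rfl⟩ := exists_eq_block_of_mem_blocksOf hB
  exact hI x

/-- A circle product of measurable activities is measurable. [folklore] -/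
theorem measurable_circ {F G : Finset (TorusSite d M) → X → ℝ} (hF : ∀ Z, IsPolymer b Z → Measurable (F Z))
    (hG : ∀ Z, IsPolymer b Z → Measurable (G Z)) {Y : Finset (TorusSite d M)} (hY : IsPolymer b Y) :
    Measurable (circ b F G Y) := by
  unfold circ
  refine measurable_pi_sum fun Z hZ => ?_
  obtain ⟨-, hZp⟩ := mem_subpolymers.1 hZ
  exact (hF Z hZp).mul (hG _ (hY.sdiff hZp))

/-- `K_out(W)` is measurable when `I`, `J` (on `𝒟(J)`, and zero off it) and `K_in` are. [folklore] -/
theorem measurable_kout {I K : Finset (TorusSite d M) → X → ℝ} {J : Finset (TorusSite d M) → Finset (TorusSite d M) → X → ℝ}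
    (hI : ∀ x, Measurable (I (block b x))) (hJ0 : ∀ U B, J U B ≠ 0 → IsSmall b U ∧ B ∈ blocksOf b U)
    (hJ : ∀ p ∈ djSet b, Measurable (J p.1 p.2)) (hK : ∀ Y, IsPolymer b Y → IsConn Y → Measurable (K Y))
    (W : Finset (TorusSite d M)) : Measurable (kout b I K J W) := by
  classical
  unfold kout
  refine measurable_pi_sum fun q hq => ?_
  obtain ⟨hadm, -⟩ := mem_cvFiber.1 hq
  refine Measurable.mul (Measurable.mul (measurable_pi_prod fun p hp => ?_) (measurable_pi_prod fun V hV => ?_))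
    (measurable_blockProd hI _)
  · exact (measurable_blockProd hI _).mul (hJ p (hadm.1 hp))
  · obtain ⟨hVp, hVc⟩ := mem_connSet.1 (hadm.2.1 hV)
    refine (hK V hVp hVc).sub ((measurable_blockProd hI _).mul (measurable_pi_sum fun B hB => ?_))
    by_cases hsmall : IsSmall b V
    · exact hJ (V, B) (mem_djSet.2 ⟨hsmall, hB⟩)
    · have h0 : J V B = 0 := by
        by_contra hne
        exact hsmall (hJ0 V B hne).1
      rw [h0]
      exact measurable_const

end Measurability

section Locality

variable {V S : Type*} [CommRing S] {b : ℕ}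

/-- A circle product of local activities is local: if `F(Z), G(Z) ∈ 𝒩(Y^□)` for polymers
`Z ⊆ Y` then `(F ∘ G)(Y) ∈ 𝒩(Y^□)`. [folklore] -/
theorem dependsOn_circ {F G : Finset (TorusSite d M) → (TorusSite d M → V) → S} {Y : Finset (TorusSite d M)}
    (hY : IsPolymer b Y) (hF : ∀ Z, IsPolymer b Z → Z ⊆ Y → DependsOn (sclosure b Y) (F Z))
    (hG : ∀ Z, IsPolymer b Z → Z ⊆ Y → DependsOn (sclosure b Y) (G Z)) : DependsOn (sclosure b Y) (circ b F G Y) := by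
  unfold circ
  refine DependsOn.sum' fun Z hZ => ?_
  obtain ⟨hZY, hZp⟩ := mem_subpolymers.1 hZ
  exact (hF Z hZp hZY).mul' (hG _ (hY.sdiff hZp) sdiff_subset)

end Locality

section GaussianStep

variable (b b' : ℕ) (C : Matrix (TorusSite d M) (TorusSite d M) ℝ)

/-- The concrete operators of the Gaussian step: `θ`, `ι` and `E = ∫ ⋯ dP_{C}` on field space
`(ℝⁿ)^Λ`. [cite: Slade2017, §4.1 (E_Cθ)] -/
abbrev thetaF (d M n : ℕ) : ((TorusSite d M → Fin n → ℝ) → ℝ) →+* ((TorusSite d M → Fin n → ℝ) → (TorusSite d M → Fin n → ℝ) → ℝ) :=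
  thetaHom (TorusSite d M → Fin n → ℝ)

/-- See `thetaF`. [cite: Slade2017, §4.1 (E_Cθ)] -/
abbrev iotaF (d M n : ℕ) : ((TorusSite d M → Fin n → ℝ) → ℝ) →+* ((TorusSite d M → Fin n → ℝ) → (TorusSite d M → Fin n → ℝ) → ℝ) :=
  iotaHom (TorusSite d M → Fin n → ℝ)

/-- See `thetaF`: `E = 𝔼_{C}` acting on the fluctuation field. [cite: Slade2017, §4.1 (E_Cθ)] -/
abbrev expectF (C : Matrix (TorusSite d M) (TorusSite d M) ℝ) (n : ℕ) :
    ((TorusSite d M → Fin n → ℝ) → (TorusSite d M → Fin n → ℝ) → ℝ) → (TorusSite d M → Fin n → ℝ) → ℝ :=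
  expectOp (fieldGaussian (TorusSite d M) C n)

/-- **The abstract `Sup`-hypotheses hold for `FlucDep`** when `Î(B) ∈ 𝒩(B^□)`, `K(Y) ∈ 𝒩(Y^□)` are
measurable and the `Ĩ_pt(B)` are measurable. [cite: BrydgesSlade2015RGV, §5.1 (proof of Proposition (prop:K3), "the field locality is straightforward")] -/
theorem supHyp_flucDep {Ihat Itil K : Finset (TorusSite d M) → (TorusSite d M → Fin n → ℝ) → ℝ}
    (hIhat : ∀ x, DependsOn (sclosure b (block b x)) (Ihat (block b x)) ∧ Measurable (Ihat (block b x)))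
    (hItil : ∀ x, Measurable (Itil (block b x)))
    (hK : ∀ Y, IsPolymer b Y → DependsOn (sclosure b Y) (K Y) ∧ Measurable (K Y)) :
    SupHyp b (iotaF d M n) (thetaF d M n) (fun D G => FlucDep D G) Ihat Itil K where
  mono := fun _ _ _ h hDD' => h.mono hDD'
  mul := fun _ _ _ h h' => h.mul h'
  sub := fun _ _ _ h h' => h.sub h'
  prod := fun _ _ _ h => FlucDep.prod h
  sum := fun _ _ _ h => FlucDep.sum h
  iota := fun D x => flucDep_iotaHom D (hItil x)
  thetaI := fun x => flucDep_thetaHom (hIhat x).1 (hIhat x).2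
  thetaK := fun Y hY => flucDep_thetaHom (hK Y hY).1 (hK Y hY).2

/-- **The factorisation hypothesis `hEfac` holds for the Gaussian `𝔼_{C}`** when `C` has `ℓ^∞`
range `r` with `r + 2^{d+1} b ≤ b' + 1`, `b' ∣ M` (finite range + torus geometry + "uncorrelated
Gaussians are independent"). [cite: BrydgesSlade2015RGV, §1.3 (display (Efaczz))] [cite: BrydgesSlade2015RGI, §2.11, Proposition (factorisation property)] -/
theorem expectF_mul_of_sepCond (hC : C.PosSemidef) {r : ℕ} (hCr : ∀ x y, r ≤ tdist x y → C x y = 0)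
    (hb : 0 < b) (hb' : 0 < b') (hbM : b' ∣ M) (hd : 0 < d) (hL : r + 2 * (2 ^ d * b) ≤ b' + 1) :
    ∀ (D₁ D₂ : Finset (TorusSite d M)) (n₁ n₂ : (TorusSite d M → Fin n → ℝ) → (TorusSite d M → Fin n → ℝ) → ℝ),
      FlucDep D₁ n₁ → FlucDep D₂ n₂ → SepCond b b' D₁ D₂ →
        expectF C n (n₁ * n₂) = expectF C n n₁ * expectF C n n₂ := by
  intro D₁ D₂ n₁ n₂ h₁ h₂ hsep
  obtain ⟨U₁, U₂, hU₁, hU₂, h12, hD₁, hD₂⟩ := hsep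
  refine expectOp_mul_of_flucDep hC ?_ h₁ h₂
  exact apply_eq_zero_of_subset_sclosure hb hb' hbM hd hL hCr hU₁ hU₂ (fun p hp q hq hpq => h12 ⟨p, hp, q, hq, hpq⟩) hD₁ hD₂

variable (D : StepData ((TorusSite d M → Fin n → ℝ) → ℝ) d M) (K : Finset (TorusSite d M) → (TorusSite d M → Fin n → ℝ) → ℝ)

/-- Regularity data for the Gaussian step: locality and measurability of `I, Î, J, K`,
measurability of `Ĩ_pt`, support of `J`, factorisation of `K`. [cite: Slade2017, Definition 6.1.2 (𝒦_j: field locality, component factorisation)] [cite: BrydgesSlade2015RGV, §4.1 ((4.1)–(4.3): support and field locality of J)] -/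
structure StepRegular (b : ℕ) (D : StepData ((TorusSite d M → Fin n → ℝ) → ℝ) d M)
    (K : Finset (TorusSite d M) → (TorusSite d M → Fin n → ℝ) → ℝ) : Prop where
  /-- `I(B) ∈ 𝒩(B^□)`, measurable -/
  locI : ∀ x, DependsOn (sclosure b (block b x)) (D.I (block b x)) ∧ Measurable (D.I (block b x))
  /-- `Î(B) ∈ 𝒩(B^□)`, measurable -/
  locIhat : ∀ x, DependsOn (sclosure b (block b x)) (D.Ihat (block b x)) ∧ Measurable (D.Ihat (block b x))
  /-- `Ĩ_pt(B)` measurable -/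
  measItil : ∀ x, Measurable (D.Itil (block b x))
  /-- `J` is supported on `𝒟(J)` -/
  suppJ : ∀ U B, D.J U B ≠ 0 → IsSmall b U ∧ B ∈ blocksOf b U
  /-- `J(U,B) ∈ 𝒩(B^□)`, measurable -/
  locJ : ∀ p ∈ djSet b, DependsOn (sclosure b p.2) (D.J p.1 p.2) ∧ Measurable (D.J p.1 p.2)
  /-- `K(Y) ∈ 𝒩(Y^□)`, measurable, for connected polymers -/
  locK : ∀ Y, IsPolymer b Y → IsConn Y → DependsOn (sclosure b Y) (K Y) ∧ Measurable (K Y)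
  /-- `K` factorises over components -/
  facK : ∀ X, IsPolymer b X → K X = ∏ Y ∈ components X, K Y

variable {b D K}

/-- `K^{(1)} = K_out(I,K,J)` is local and measurable. [folklore] -/
theorem StepRegular.loc_kOne (h : StepRegular b D K) {W : Finset (TorusSite d M)} (hW : IsPolymer b W) :
    DependsOn (sclosure b W) (kOne b D K W) ∧ Measurable (kOne b D K W) :=
  ⟨dependsOn_kout (fun x => (h.locI x).1) h.suppJ (fun p hp => (h.locJ p hp).1) (fun Y hY hYc => (h.locK Y hY hYc).1) hW,
    measurable_kout (fun x => (h.locI x).2) h.suppJ (fun p hp => (h.locJ p hp).2) (fun Y hY hYc => (h.locK Y hY hYc).2) W⟩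

/-- `K^{(2)} = K^{(1)} ∘ δI^{(2)}` is local and measurable. [cite: BrydgesSlade2015RGV, §4.3 (Lemma (lem:K2)(ii): "The field locality … can be verified by inspection")] -/
theorem StepRegular.loc_kTwo (h : StepRegular b D K) {Y : Finset (TorusSite d M)} (hY : IsPolymer b Y) :
    DependsOn (sclosure b Y) (kTwo b D K Y) ∧ Measurable (kTwo b D K Y) := by
  have hδ : ∀ x, DependsOn (sclosure b (block b x)) ((D.I - D.Ihat) (block b x)) := fun x =>
    (h.locI x).1.sub' (h.locIhat x).1
  refine ⟨dependsOn_circ hY (fun Z hZp hZY => (h.loc_kOne hZp).1.mono (sclosure_mono b hZY))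
    (fun Z hZp hZY => dependsOn_blockProd_sclosure hδ hZp hZY), ?_⟩
  exact measurable_circ (fun Z hZ => (h.loc_kOne hZ).2)
    (fun Z _ => measurable_blockProd (fun x => (h.locI x).2.sub (h.locIhat x).2) Z) hY

/-- `K^{(1)}` is multiplicative over non-touching polymers. [folklore] -/
theorem kOne_union {A B : Finset (TorusSite d M)} (hA : IsPolymer b A) (hB : IsPolymer b B)
    (hAB : ¬ Touch A B) : kOne b D K (A ∪ B) = kOne b D K A * kOne b D K B :=
  mul_of_factorises (fun _ hX => kout_eq_prod_components D.I K D.J hX) hA hB hAB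

/-- `K^{(2)}` is multiplicative over non-touching polymers ("component factorisation … can be
verified by inspection"). [cite: BrydgesSlade2015RGV, §4.3 (Lemma (lem:K2)(ii))] -/
theorem kTwo_union {Y₁ Y₂ : Finset (TorusSite d M)} (hY₁ : IsPolymer b Y₁) (hY₂ : IsPolymer b Y₂)
    (h12 : ¬ Touch Y₁ Y₂) : kTwo b D K (Y₁ ∪ Y₂) = kTwo b D K Y₁ * kTwo b D K Y₂ := by
  refine circ_union_eq_mul hY₁ hY₂ (disjoint_of_not_touch h12) (fun A B hA hB hA1 hB2 => ?_) (fun A B hA hB hA1 hB2 => ?_)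
  · exact kOne_union hA hB fun ht => h12 (ht.mono hA1 hB2)
  · exact blockProd_union _ hA hB (((disjoint_of_not_touch h12).mono_left hA1).mono_right hB2)

/-- `K^{(2)}(∅) = 1`. [folklore] -/
theorem kTwo_empty : kTwo b D K ∅ = 1 := by
  unfold kTwo circ
  rw [subpolymers_empty, Finset.sum_singleton]
  simp [kOne, kout_empty]

variable (b)

/-- **`K^{(3)}` factorises over components for the Gaussian step** (all hypotheses of the abstract
`kthree_eq_prod_components` discharged: field locality via `FlucDep`, (Efaczz) via the finite range
of `C` and the torus geometry, factorisation of `K^{(2)}` from that of `K`). [cite: BrydgesSlade2015RGV, §5.1, Proposition (prop:K3) ("K^{(3)} ∈ 𝒦_{j+1}")] -/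
theorem kThree_eq_prod_components_gauss (hreg : StepRegular b D K) (hbb : b ∣ b') (hC : C.PosSemidef) {r : ℕ}
    (hCr : ∀ x y, r ≤ tdist x y → C x y = 0) (hb : 0 < b) (hb' : 0 < b') (hbM : b' ∣ M) (hd : 0 < d)
    (hL : r + 2 * (2 ^ d * b) ≤ b' + 1) {U : Finset (TorusSite d M)} (hU : IsPolymer b' U) :
    kThree b b' (iotaF d M n) (thetaF d M n) (expectF C n) D K U =
      ∏ Z ∈ components U, kThree b b' (iotaF d M n) (thetaF d M n) (expectF C n) D K Z := by
  unfold kThree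
  exact kthree_eq_prod_components (iotaF d M n) (thetaF d M n) (expectF C n) (fun D G => FlucDep D G) hbb
    (supHyp_flucDep b hreg.locIhat hreg.measItil fun Y hY => hreg.loc_kTwo hY)
    (expectF_mul_of_sepCond b b' C hC hCr hb hb' hbM hd hL)
    (fun Y₁ Y₂ hY₁ hY₂ h12 => kTwo_union hY₁ hY₂ h12) kTwo_empty (expectOp_one _) hU

/-- **The representation identity of the Gaussian renormalisation group step** (Slade §6.3:
"`K₊ = K₊(V,K)` … with the property that `𝔼₊θ(I ∘ K)(Λ) = e^{-δu₊|Λ|}(I₊ ∘ K₊)(Λ)`"; [BS-rg-step]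
(rgmapdef-bis)): for the composite `K₊ = Map 6 ∘ ⋯ ∘ Map 1 (K)` with `𝔼₊ = 𝔼_{C}` Gaussian of
`ℓ^∞`-range `r`, `r + 2^{d+1}L^j ≤ L^{j+1} + 1`, `L^{j+1} ∣ L^N`, the remaining hypotheses being
the integrability of the Map-3 terms, the support of `h_ldg` and `I_pt⁺ = e^{-δu₊|B|} I₊`.
[cite: Slade2017, §6.3 (defining property of (U₊, K₊))] [cite: BrydgesSlade2015RGV, §3.1 ((3.2)–(3.8))] -/
theorem expectF_theta_circ_eq_kPlus (hreg : StepRegular b D K) (hbb : b ∣ b') (hC : C.PosSemidef) {r : ℕ}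
    (hCr : ∀ x y, r ≤ tdist x y → C x y = 0) (hb : 0 < b) (hb' : 0 < b') (hbM : b' ∣ M) (hd : 0 < d)
    (hL : r + 2 * (2 ^ d * b) ≤ b' + 1)
    (hP : ∀ Y, IsPolymer b Y → SecIntegrable (fieldGaussian (TorusSite d M) C n)
      (circ b (blockProd b (deltaI (iotaF d M n) (thetaF d M n) D.Ihat D.Itil)) (fun X => thetaF d M n (kTwo b D K X)) Y))
    (hh : ∀ U B, D.h U B ≠ 0 → IsSmall b' U ∧ B ∈ blocksOf b' U)
    (hI : ∀ x, D.Iplus' (block b' x) = D.c ^ (block b' x).card * D.Iplus (block b' x)) (hcc : D.c * D.c' = 1) :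
    expectF C n (thetaF d M n (circ b (blockProd b D.I) K univ)) =
      D.c ^ (univ : Finset (TorusSite d M)).card *
        circ b' (blockProd b' D.Iplus) (kPlus b b' (iotaF d M n) (thetaF d M n) (expectF C n) D K) univ :=
  expect_theta_circ_eq_kPlus b b' (iotaF d M n) (thetaF d M n) (expectF C n) D K hbb hreg.facK hreg.suppJ
    (SecIntegrable (fieldGaussian (TorusSite d M) C n)) (expectOp_sum_iotaHom_mul _) hP
    (fun _ hX => kThree_eq_prod_components_gauss b b' C hreg hbb hC hCr hb hb' hbM hd hL hX) hh hI hcc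

end GaussianStep

end Polymer

end LongRangePhi4

end Literature.Barriers.CriticalPhenomena
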